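import Mathlib
import HarnessLib
import Summits.Langlands.Langlands.Theses.MirrorPairReflection
import Summits.Langlands.Langlands.Theorems.MirrorPairReflectionMirrorCriterionEndpoint
import Summits.Langlands.Langlands.Theorems.SplitPrimeDescentLadderTwistModelPrelude
import Literature.NumberTheory.GaloisRepresentations.CalegariEvenFontaineMazurTwo
import Literature.NumberTheory.GaloisRepresentations.CyclotomicCharacterSurjectiveProofs
import Literature.NumberTheory.GaloisRepresentations.AbsGaloisGroupCompact

/-!
# `MirrorPairReflection.MirrorCriterion` — proof of the item (stmt-Langlands-12835)

**Statement** (route `MirrorPairReflection`, support item `MirrorCriterion`, rank 3): assume the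
Kummer–Herbrand splitting criterion (verbatim the item `KummerHerbrandSplitting`, taken as the
hypothesis).  Let `p` be odd, `σ : Γ_ℚ → GL₂(ℚ̄_p)` continuous, irreducible, unramified outside `p`,
with `tr σ(g) ≡ χ(g)^a + χ(g)^b (mod 𝔪)` for all `g` (`χ` the `p`-adic cyclotomic character),
`a + b` even and `a ≢ b (mod p-1)`; put `m := (b - a) mod (p - 1)`.  Then `p ∣ B_m` and
`p ∣ B_{p-1-m}`.  Closing theorem (by name): `mirrorCriterion_proof`.

**Proof (Ribet's two lattice endpoints, explicit for `n = 2` over `ℤ̄_p`).**  Write `A = χ^a`,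
`B = χ^b` (values in `ℤ_p ⊂ ℚ̄_p`) and fix `g₀ ∈ Γ_ℚ` with `A(g₀) ≢ B(g₀)`: the cyclotomic
character is onto `ℤ_pˣ` (`GaloisRep.cyclotomicCharacter_surjective`) and `(ℤ/p)ˣ` is cyclic of
order `p - 1 ∤ b - a`.  The endpoint `core` (file `…MirrorCriterionEndpoint`) gives a
`ℤ̄_p`-integral frame whose reduction `r : Γ_ℚ → GL₂(ℤ̄_p/𝔪)` is continuous (open kernel,
`isOpen_ker_residualRep`, tree lemma `…CofinalResidualDoor.continuous_of_isOpen_ker'`), unramified outside `p`, of shape `(ω^a * ; 0 ω^b)` with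
`ω = ι ∘ (χ mod p)` (`ι : ℤ/p → ℤ̄_p/𝔪` canonical; compatibility `exists_intMap`), with `r(g₀)`
diagonal with distinct entries and `r(g₁)₀₁ = 1`; such an `r` is not split (`not_split`), so the
Kummer–Herbrand hypothesis (contrapositive) gives `p ∣ B_{(a-b) mod (p-1)} = B_{p-1-m}`
(`endpoint`, `toNat_index`).  Exchanging `a` and `b` gives `p ∣ B_m`.
No conjecture or named fact is used; no definition is introduced.
Ref: K. Ribet, Invent. Math. 34 (1976) 151–162, Prop. 2.1 and Thm. 1.3.
(decomp-langlands lens-6, g44.)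
-/

set_option linter.dupNamespace false -- project-wide option (lakefile weak.linter.dupNamespace); `Summit.Langlands.Langlands` is the mandated namespace

noncomputable section

namespace Summit.Langlands.Langlands.Theorems.MirrorPairReflectionMirrorCriterion

open Field NumberField IsDedekindDomain IsLocalRing
open Literature.NumberTheory.GaloisRepresentations
open scoped MatrixGroups NumberField Matrix

section Main

variable (p : ℕ) [Fact p.Prime]

/-- `ℤ_p → ℚ_p → ℚ̄_p` lands in `ℤ̄_p`. [folklore] -/
theorem algebraMap_padicInt_mem (z : ℤ_[p]) :
    algebraMap ℚ_[p] (PadicAlgCl p) (z : ℚ_[p]) ∈ padicAlgClIntegers p := by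
  rw [padicAlgCl_mem_valuationSubring_iff, norm_algebraMap', PadicInt.padic_norm_e_of_padicInt]
  exact z.norm_le_one

/-- The inclusion `ℤ_p → ℤ̄_p` as a ring homomorphism, and its compatibility with the residue maps:
`ℤ_p → ℤ̄_p → ℤ̄_p/𝔪` equals `ℤ_p → ℤ/p → ℤ̄_p/𝔪` (both kill `p`; ring maps out of `ℤ/p` are
unique). [folklore] -/
theorem exists_intMap :
    ∃ f : ℤ_[p] →+* padicAlgClIntegers p,
      (∀ z, ((f z : padicAlgClIntegers p) : PadicAlgCl p) =
        algebraMap ℚ_[p] (PadicAlgCl p) (z : ℚ_[p])) ∧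
      ∀ z, residue (padicAlgClIntegers p) (f z) =
        zmodToPadicAlgClResidueField p (PadicInt.toZMod z) := by
  let f : ℤ_[p] →+* padicAlgClIntegers p :=
    ((algebraMap ℚ_[p] (PadicAlgCl p)).comp (PadicInt.Coe.ringHom (p := p))).codRestrict
      (padicAlgClIntegers p) (algebraMap_padicInt_mem p)
  let φ : ℤ_[p] →+* padicAlgClResidueField p := (residue (padicAlgClIntegers p)).comp f
  have hker : RingHom.ker (PadicInt.toZMod (p := p)) ≤ RingHom.ker φ := by
    rw [PadicInt.ker_toZMod, PadicInt.maximalIdeal_eq_span_p, Ideal.span_le,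
      Set.singleton_subset_iff, SetLike.mem_coe, RingHom.mem_ker, map_natCast]
    haveI := charP_padicAlgClResidueField p
    exact CharP.cast_eq_zero _ p
  have hφ : ∀ z : ℤ_[p], φ z = zmodToPadicAlgClResidueField p (PadicInt.toZMod z) := by
    intro z
    rw [Subsingleton.elim (zmodToPadicAlgClResidueField p)
      ((PadicInt.toZMod (p := p)).liftOfRightInverse (ZMod.cast : ZMod p → ℤ_[p])
        (ZMod.ringHom_rightInverse _) ⟨φ, hker⟩),
      RingHom.liftOfRightInverse_comp_apply]
  exact ⟨f, fun z => rfl, hφ⟩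

/-- **One Kummer endpoint.**  Under the Kummer–Herbrand splitting hypothesis, an odd-`p`
irreducible `σ : Γ_ℚ → GL₂(ℚ̄_p)` unramified outside `p` with `tr σ ≡ χ^a + χ^b`, `a + b` even,
`a ≢ b (mod p-1)`, forces `p ∣ B_{(a-b) mod (p-1)}` (the lattice whose reduction has `ω^a` on the
stable line). [Ribet 1976, Prop. 2.1, made explicit] -/
theorem endpoint
    (hK : Summit.Langlands.Langlands.Theses.MirrorPairReflection.KummerHerbrandSplitting)
    (hp : p ≠ 2) (σ : FramedGaloisRep ℚ (PadicAlgCl p) 2) (a b : ℕ)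
    (hU : ∀ v : HeightOneSpectrum (𝓞 ℚ), ((p : ℕ) : 𝓞 ℚ) ∉ v.asIdeal → σ.IsUnramifiedAt v)
    (hE : Even (a + b)) (hab : ¬ ((p : ℤ) - 1 ∣ (a : ℤ) - b))
    (hT : ∀ g : absoluteGaloisGroup ℚ, ‖FramedRep.trace σ g -
      ((algebraMap ℚ_[p] (PadicAlgCl p)
          (((GaloisRep.cyclotomicCharacter ℚ p g : ℤ_[p]ˣ) : ℤ_[p]) : ℚ_[p])) ^ a +
        (algebraMap ℚ_[p] (PadicAlgCl p)
          (((GaloisRep.cyclotomicCharacter ℚ p g : ℤ_[p]ˣ) : ℤ_[p]) : ℚ_[p])) ^ b)‖ < 1)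
    (hI : FramedRep.IsIrreducible σ) :
    (p : ℤ) ∣ (bernoulli ((((a : ℤ) - b) % ((p : ℤ) - 1)).toNat)).num := by
  classical
  haveI : CompactSpace (absoluteGaloisGroup ℚ) := absoluteGaloisGroup_compactSpace ℚ
  set χ := GaloisRep.cyclotomicCharacter ℚ p with hχ
  /- the characters `u = χ` (viewed in `ℚ̄_p`), `A = u^a`, `B = u^b` -/
  obtain ⟨u, hu⟩ : ∃ u : absoluteGaloisGroup ℚ →* PadicAlgCl p, ∀ g,
      u g = algebraMap ℚ_[p] (PadicAlgCl p) (((χ g : ℤ_[p]ˣ) : ℤ_[p]) : ℚ_[p]) :=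
    ⟨(algebraMap ℚ_[p] (PadicAlgCl p)).toMonoidHom.comp
      ((PadicInt.Coe.ringHom (p := p)).toMonoidHom.comp
        ((Units.coeHom ℤ_[p]).comp χ.toMonoidHom)), fun g => rfl⟩
  obtain ⟨A, hA⟩ : ∃ A : absoluteGaloisGroup ℚ →* PadicAlgCl p, ∀ g, A g = u g ^ a :=
    ⟨(powMonoidHom a).comp u, fun g => rfl⟩
  obtain ⟨B, hB⟩ : ∃ B : absoluteGaloisGroup ℚ →* PadicAlgCl p, ∀ g, B g = u g ^ b :=
    ⟨(powMonoidHom b).comp u, fun g => rfl⟩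
  have hun : ∀ g, ‖u g‖ = 1 := fun g => by
    rw [hu, norm_algebraMap', PadicInt.padic_norm_e_of_padicInt]
    exact PadicInt.isUnit_iff.mp (Units.isUnit _)
  have hA1 : ∀ g, ‖A g‖ ≤ 1 := fun g => by rw [hA, norm_pow, hun, one_pow]
  have hB1 : ∀ g, ‖B g‖ ≤ 1 := fun g => by rw [hB, norm_pow, hun, one_pow]
  have h2 : ‖(2 : PadicAlgCl p)‖ = 1 := by
    have e : (2 : PadicAlgCl p) = algebraMap ℚ_[p] (PadicAlgCl p) ((2 : ℤ) : ℚ_[p]) := by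
      simp only [Int.cast_ofNat, map_ofNat]
    rw [e, norm_algebraMap']
    refine le_antisymm (Padic.norm_int_le_one 2) (not_lt.1 fun hlt => hp ?_)
    have hdvd : (p : ℤ) ∣ 2 := Padic.norm_intCast_lt_one_iff.1 hlt
    have : p ∣ 2 := by exact_mod_cast hdvd
    exact (Nat.prime_dvd_prime_iff_eq Fact.out Nat.prime_two).1 this
  /- an element `g₀` with `χ(g₀)^a ≢ χ(g₀)^b`: lift a generator of `(ℤ/p)ˣ` -/
  obtain ⟨g₀, hg₀⟩ : ∃ g₀ : absoluteGaloisGroup ℚ, ‖A g₀ - B g₀‖ = 1 := by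
    obtain ⟨ζ, hζ⟩ := IsCyclic.exists_generator (α := (ZMod p)ˣ)
    have hζord : orderOf ζ = p - 1 := by
      rw [orderOf_eq_card_of_forall_mem_zpowers hζ, Nat.card_eq_fintype_card, ZMod.card_units]
    have hright : Function.RightInverse (ZMod.cast : ZMod p → ℤ_[p]) (PadicInt.toZMod (p := p)) :=
      ZMod.ringHom_rightInverse _
    set z₀ : ℤ_[p] := ((ζ : ZMod p).cast : ℤ_[p]) with hz₀def
    have hz₀ : PadicInt.toZMod z₀ = (ζ : ZMod p) := hright _
    have hz₀u : IsUnit z₀ := by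
      by_contra hnu
      have hmem : z₀ ∈ maximalIdeal ℤ_[p] := (IsLocalRing.mem_maximalIdeal _).mpr hnu
      rw [← PadicInt.ker_toZMod, RingHom.mem_ker, hz₀] at hmem
      exact ζ.ne_zero hmem
    obtain ⟨g₀, hg₀⟩ := GaloisRep.cyclotomicCharacter_surjective ℚ p
      (fun n hn => Polynomial.cyclotomic.irreducible_rat hn) hz₀u.unit
    refine ⟨g₀, ?_⟩
    have hval : ((χ g₀ : ℤ_[p]ˣ) : ℤ_[p]) = z₀ := by rw [hg₀, IsUnit.unit_spec]
    have e : A g₀ - B g₀ =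
        algebraMap ℚ_[p] (PadicAlgCl p) (((z₀ ^ a - z₀ ^ b : ℤ_[p]) : ℚ_[p])) := by
      rw [hA, hB, hu, hval, PadicInt.coe_sub, PadicInt.coe_pow, PadicInt.coe_pow, map_sub, map_pow,
        map_pow]
    rw [e, norm_algebraMap', PadicInt.padic_norm_e_of_padicInt]
    refine le_antisymm (PadicInt.norm_le_one _) (not_lt.1 fun hlt => hab ?_)
    have hmem : z₀ ^ a - z₀ ^ b ∈ maximalIdeal ℤ_[p] :=
      (IsLocalRing.mem_maximalIdeal _).mpr (PadicInt.mem_nonunits.mpr hlt)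
    rw [← PadicInt.ker_toZMod, RingHom.mem_ker, map_sub, map_pow, map_pow, hz₀, sub_eq_zero,
      ← Units.val_pow_eq_pow_val, ← Units.val_pow_eq_pow_val, Units.val_inj,
      pow_eq_pow_iff_modEq, hζord] at hmem
    have hdvd := (Nat.modEq_iff_dvd.1 hmem)
    have hp1 : ((p - 1 : ℕ) : ℤ) = (p : ℤ) - 1 := by
      have := (Fact.out : p.Prime).one_le
      push_cast [Nat.cast_sub this]
      ring
    rw [hp1] at hdvd
    exact dvd_sub_comm.1 hdvd
  /- the Ribet endpoint -/
  have hT' : ∀ g, ‖(σ g).val.trace - (A g + B g)‖ < 1 := fun g => by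
    rw [hA, hB, hu]; exact hT g
  obtain ⟨P, ρ₀, g₁, hP, h10, h00, h11, hg₀01, hg₁01⟩ := core σ A B hA1 hB1 h2 hg₀ hT' hI
  /- its reduction `r : Γ_ℚ → GL₂(ℤ̄_p/𝔪)` -/
  letI : TopologicalSpace (padicAlgClResidueField p) := ⊥
  haveI : DiscreteTopology (padicAlgClResidueField p) := ⟨rfl⟩
  haveI : CharP (padicAlgClResidueField p) p := charP_padicAlgClResidueField p
  obtain ⟨r, hr⟩ : ∃ r : absoluteGaloisGroup ℚ →* GL (Fin 2) (padicAlgClResidueField p),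
      r = (Matrix.GeneralLinearGroup.map (residue (padicAlgClIntegers p))).comp ρ₀ := ⟨_, rfl⟩
  have hr_apply : ∀ g (i j : Fin 2),
      (r g).val i j = residue (padicAlgClIntegers p) ((ρ₀ g).val i j) := by
    intro g i j; rw [hr]; rfl
  have hker : IsOpen (r.ker : Set (absoluteGaloisGroup ℚ)) := by
    rw [hr]; exact isOpen_ker_residualRep isOpen_setOf_mem_maximalIdeal_padicAlgClIntegers hP
  have hcont : Continuous r :=
    SplitPrimeDescentLadder.V3Birth.CofinalResidualDoor.continuous_of_isOpen_ker' r hker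
  obtain ⟨ρbar, hρbar⟩ : ∃ ρbar : FramedGaloisRep ℚ (padicAlgClResidueField p) 2,
      ∀ g, ρbar g = r g := ⟨⟨r, hcont⟩, fun g => rfl⟩
  /- the hypotheses of the Kummer–Herbrand criterion -/
  have hinj : Function.Injective
      (Matrix.GeneralLinearGroup.map (n := Fin 2) (padicAlgClIntegers p).subtype) := by
    intro X Y h
    refine Units.ext (Matrix.ext fun i j => (padicAlgClIntegers p).subtype_injective ?_)
    have := congrArg (fun M : GL (Fin 2) (PadicAlgCl p) => M.val i j) h
    simpa [Matrix.GeneralLinearGroup.map] using this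
  have hU' : ∀ v : HeightOneSpectrum (𝓞 ℚ), ((p : ℕ) : 𝓞 ℚ) ∉ v.asIdeal →
      ρbar.IsUnramifiedAt v := by
    intro v hv 𝔓 h𝔓 τ hτ
    have hσ : σ τ = 1 := hU v hv 𝔓 h𝔓 τ hτ
    have h1 : ρ₀ τ = 1 := hinj (by rw [hP, hσ, mul_one, inv_mul_cancel, map_one])
    rw [hρbar, hr, MonoidHom.comp_apply, h1, map_one]
  obtain ⟨f, hf, hfres⟩ := exists_intMap p
  have hAint : ∀ g, (⟨A g, (padicAlgCl_mem_valuationSubring_iff p _).2 (hA1 g)⟩ : padicAlgClIntegers p) =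
      (f ((χ g : ℤ_[p]ˣ) : ℤ_[p])) ^ a := by
    intro g
    apply Subtype.ext
    show A g = (((f ((χ g : ℤ_[p]ˣ) : ℤ_[p])) ^ a : padicAlgClIntegers p) : PadicAlgCl p)
    rw [SubmonoidClass.coe_pow, hf, hA, hu]
  have hBint : ∀ g, (⟨B g, (padicAlgCl_mem_valuationSubring_iff p _).2 (hB1 g)⟩ : padicAlgClIntegers p) =
      (f ((χ g : ℤ_[p]ˣ) : ℤ_[p])) ^ b := by
    intro g
    apply Subtype.ext
    show B g = (((f ((χ g : ℤ_[p]ˣ) : ℤ_[p])) ^ b : padicAlgClIntegers p) : PadicAlgCl p)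
    rw [SubmonoidClass.coe_pow, hf, hB, hu]
  have hshape : ∀ g : absoluteGaloisGroup ℚ,
      ((ρbar g : GL (Fin 2) (padicAlgClResidueField p)) :
          Matrix (Fin 2) (Fin 2) (padicAlgClResidueField p)) 1 0 = 0 ∧
      ((ρbar g : GL (Fin 2) (padicAlgClResidueField p)) :
          Matrix (Fin 2) (Fin 2) (padicAlgClResidueField p)) 0 0 =
        (zmodToPadicAlgClResidueField p (PadicInt.toZMod ((χ g : ℤ_[p]ˣ) : ℤ_[p]))) ^ a ∧
      ((ρbar g : GL (Fin 2) (padicAlgClResidueField p)) :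
          Matrix (Fin 2) (Fin 2) (padicAlgClResidueField p)) 1 1 =
        (zmodToPadicAlgClResidueField p (PadicInt.toZMod ((χ g : ℤ_[p]ˣ) : ℤ_[p]))) ^ b := by
    intro g
    refine ⟨?_, ?_, ?_⟩
    · rw [hρbar, hr_apply, residue_eq_zero_iff, mem_maximalIdeal_padicAlgClIntegers_iff_norm_lt_one]; exact h10 g
    · rw [hρbar, hr_apply, (residue_eq_residue_iff_norm_sub_lt_one ((ρ₀ g).val 0 0)
        ⟨A g, (padicAlgCl_mem_valuationSubring_iff p _).2 (hA1 g)⟩).2 (h00 g), hAint g, map_pow, hfres]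
    · rw [hρbar, hr_apply, (residue_eq_residue_iff_norm_sub_lt_one ((ρ₀ g).val 1 1)
        ⟨B g, (padicAlgCl_mem_valuationSubring_iff p _).2 (hB1 g)⟩).2 (h11 g), hBint g, map_pow, hfres]
  /- Kummer–Herbrand by contradiction: the reduction is not split -/
  by_contra hBern
  obtain ⟨Pk, hPk⟩ := hK p hp (padicAlgClResidueField p) (zmodToPadicAlgClResidueField p) ρbar
    a b hU' hE hab hBern hshape
  have hne : (r g₀).val 0 0 ≠ (r g₀).val 1 1 := by
    rw [hr_apply, hr_apply, Ne, residue_eq_residue_iff_norm_sub_lt_one, not_lt]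
    have hn : ‖(((ρ₀ g₀).val 0 0 : padicAlgClIntegers p) : PadicAlgCl p) -
        (((ρ₀ g₀).val 1 1 : padicAlgClIntegers p) : PadicAlgCl p)‖ = 1 := by
      refine norm_eq_one_of_cong hg₀ ?_
      have e : (A g₀ - B g₀) - ((((ρ₀ g₀).val 0 0 : padicAlgClIntegers p) : PadicAlgCl p) -
          (((ρ₀ g₀).val 1 1 : padicAlgClIntegers p) : PadicAlgCl p)) =
          ((((ρ₀ g₀).val 1 1 : padicAlgClIntegers p) : PadicAlgCl p) - B g₀) -
            ((((ρ₀ g₀).val 0 0 : padicAlgClIntegers p) : PadicAlgCl p) - A g₀) := by ring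
      rw [e]; exact norm_sub_lt_one (h11 g₀) (h00 g₀)
    rw [hn]
  have h01r : (r g₀).val 0 1 = 0 := by
    rw [hr_apply, residue_eq_zero_iff, mem_maximalIdeal_padicAlgClIntegers_iff_norm_lt_one, hg₀01, norm_zero]; exact one_pos
  have h10r : (r g₀).val 1 0 = 0 := by
    rw [hr_apply, residue_eq_zero_iff, mem_maximalIdeal_padicAlgClIntegers_iff_norm_lt_one]; exact h10 g₀
  have h1r : (r g₁).val 0 1 ≠ 0 := by
    rw [hr_apply, Ne, residue_eq_zero_iff, mem_maximalIdeal_padicAlgClIntegers_iff_norm_lt_one, hg₁01, norm_one]; exact lt_irrefl 1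
  refine not_split r h01r h10r hne h1r ⟨Pk, fun g => ?_⟩
  rw [← hρbar]; exact hPk g

omit [Fact p.Prime] in
/-- The two Kummer indices are mirror images: `(a-b) mod (p-1) = (p-1) - ((b-a) mod (p-1))`
when `p - 1 ∤ b - a`. -/
theorem toNat_index (a b : ℕ) (hp : 3 ≤ p) (h : ¬ ((p : ℤ) - 1 ∣ (b : ℤ) - a)) :
    (((a : ℤ) - b) % ((p : ℤ) - 1)).toNat =
      p - 1 - ((((b : ℤ) - a) % ((p : ℤ) - 1)).toNat) := by
  have hq0 : (0 : ℤ) < (p : ℤ) - 1 := by omega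
  have hm0 : 0 ≤ ((b : ℤ) - a) % ((p : ℤ) - 1) := Int.emod_nonneg _ hq0.ne'
  have hmq : ((b : ℤ) - a) % ((p : ℤ) - 1) < (p : ℤ) - 1 := Int.emod_lt_of_pos _ hq0
  have hmne : ((b : ℤ) - a) % ((p : ℤ) - 1) ≠ 0 := fun h0 => h (Int.dvd_of_emod_eq_zero h0)
  have hdiv : ((p : ℤ) - 1) * (((b : ℤ) - a) / ((p : ℤ) - 1)) + ((b : ℤ) - a) % ((p : ℤ) - 1) =
      (b : ℤ) - a := Int.mul_ediv_add_emod _ _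
  have hneg : ((a : ℤ) - b) % ((p : ℤ) - 1) =
      ((p : ℤ) - 1) - ((b : ℤ) - a) % ((p : ℤ) - 1) := by
    have e : (a : ℤ) - b = (((p : ℤ) - 1) - ((b : ℤ) - a) % ((p : ℤ) - 1)) +
        ((p : ℤ) - 1) * (-(((b : ℤ) - a) / ((p : ℤ) - 1)) - 1) := by linarith
    rw [e, Int.add_mul_emod_self_left]
    exact Int.emod_eq_of_lt (by omega) (by omega)
  rw [hneg]
  omega

end Main

/-- **`MirrorCriterion`** (route `MirrorPairReflection`, item stmt-Langlands-12835): the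
Kummer–Herbrand splitting criterion implies Ribet's two-sided divisibility `p ∣ B_m` and
`p ∣ B_{p-1-m}` for irreducible `σ : Γ_ℚ → GL₂(ℚ̄_p)` unramified outside `p` with
`tr σ ≡ χ^a + χ^b`, `m = (b - a) mod (p - 1)`. -/
theorem mirrorCriterion_proof :
    Summit.Langlands.Langlands.Theses.MirrorPairReflection.MirrorCriterion := by
  intro hK p _ hp σ a b hU hE h1 hT hI
  have hp3 : 3 ≤ p := by
    have h2 := (Fact.out : p.Prime).two_le
    omega
  have hab : ¬ ((p : ℤ) - 1 ∣ (a : ℤ) - b) := fun h => h1 (dvd_sub_comm.1 h)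
  have D1 := endpoint p hK hp σ a b hU hE hab hT hI
  have D2 := endpoint p hK hp σ b a hU (by rwa [add_comm]) h1
    (fun g => by rw [add_comm]; exact hT g) hI
  exact ⟨D2, by rw [← toNat_index p a b hp3 h1]; exact D1⟩

end Summit.Langlands.Langlands.Theorems.MirrorPairReflectionMirrorCriterion

end
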